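import Mathlib

/-!
# SoloInformedCyclicNoDihedral — a cyclic group carries no dihedral pair (Part II §7.11 (14), READING (i))

In §7.11 (14) the 5-class group `A = Cl(L){5}` of `L = F(μ₅, ε^{1/5})` carries `σ` (a generator of `Gal(L/F(μ₅))`, order 5) and the
reflection `τ̃` with `τ̃ σ τ̃ = σ⁻¹`.  When the unit symbol vanishes, `σ ≠ 1` on `A` and `|A| = 25`; the text concludes `A ≅ (ℤ/5)²` rather than
`ℤ/25` because additive automorphisms of a cyclic group commute, so a dihedral relation `τσ = σ⁻¹τ` forces `σ² = 1`, and odd order forces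
`σ = 1`.  This file checks exactly that, for `ZMod n`.

* `soloInformed_addAut_zmod_comm`      : any two additive automorphisms of `ZMod n` commute (pointwise).
* `soloInformed_zmod_no_dihedral_pair` : `τ (σ a) = σ⁻¹ (τ a)` for all `a` and `σ^[m] = id` with `m` odd ⇒ `σ = id` on `ZMod n`.
-/

namespace Summit.Langlands.Langlands.Theorems

/-- Additive endomorphisms of `ZMod n` commute pointwise: each is multiplication by its value at `1`. -/
theorem soloInformed_addAut_zmod_comm {n : ℕ} [NeZero n] (σ τ : ZMod n ≃+ ZMod n) (a : ZMod n) :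
    σ (τ a) = τ (σ a) := by
  -- every additive map is multiplication by its value at 1
  have key : ∀ (φ : ZMod n ≃+ ZMod n) (x : ZMod n), φ x = x * φ 1 := by
    intro φ x
    conv_lhs => rw [← ZMod.natCast_zmod_val x]
    rw [← nsmul_one, map_nsmul, nsmul_eq_mul, ZMod.natCast_zmod_val]
  rw [key τ a, key σ (a * τ 1), key σ a, key τ (a * σ 1)]
  ring

/-- A CYCLIC GROUP CARRIES NO DIHEDRAL PAIR: if additive automorphisms `σ, τ` of `ZMod n` satisfy `τ σ = σ⁻¹ τ` and `σ` has odd order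
(`σ^[m] = id`, `m` odd), then `σ = id`.  (Used in §7.11 (14) READING (i): `Cl(L){5}` with `σ ≠ 1` of order 5 and the reflection `τ̃` cannot be
cyclic of order 25, hence is `(ℤ/5)²`.) -/
theorem soloInformed_zmod_no_dihedral_pair {n : ℕ} [NeZero n] (σ τ : ZMod n ≃+ ZMod n)
    (hrel : ∀ a, τ (σ a) = σ.symm (τ a)) {m : ℕ} (hm : Odd m) (hσm : ∀ a, (⇑σ)^[m] a = a) :
    ∀ a, σ a = a := by
  -- σ² = 1 : from στ = τσ (commutativity) and τσ = σ⁻¹τ, cancelling the bijection τ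
  have hsq : ∀ a, σ (σ a) = a := by
    intro a
    obtain ⟨b, rfl⟩ := τ.surjective a
    have h1 : σ (τ b) = σ.symm (τ b) := by rw [← hrel b, soloInformed_addAut_zmod_comm σ τ b]
    rw [h1, σ.apply_symm_apply]
  -- odd order: σ^[2k+1] = σ
  obtain ⟨k, rfl⟩ := hm
  have hiter : ∀ j a, (⇑σ)^[2 * j] a = a := by
    intro j
    induction j with
    | zero => intro a; simp
    | succ j ih =>
      intro a
      rw [show 2 * (j + 1) = 2 * j + 2 by ring, Function.iterate_add_apply,
        show (⇑σ)^[2] a = σ (σ a) from rfl, hsq, ih]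
  intro a
  have := hσm a
  rw [Function.iterate_add_apply, Function.iterate_one, hiter] at this
  exact this

end Summit.Langlands.Langlands.Theorems
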